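import Literature.NumberTheory.Sieve.Maynard2016Lemma7Assembly
import Literature.NumberTheory.Sieve.Maynard2016BadPrimes
import Literature.NumberTheory.Sieve.Maynard2016CoupledProductW

/-!
# Maynard (2016), Lemma 7: the bad primes `Bad⁷` and `T⁷ → 0` (analogue of (6.13)–(6.14))

J. Maynard, *Large gaps between primes*, Ann. of Math. (2) 183 (2016), 915–933 = arXiv:1408.5110,
§6, proof of Lemma 7 ("by an argument analogous to that of Lemma 6"), with the divisibility
conditions (Div1)–(Div3) of `Maynard2016Lemma7System`.

For the `φ`-weighted coupled Euler product on the `k − 1` free slots `{ℓ // ℓ ≠ i}` with coupling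
`restrictPairs i i (couplingSet7 p₀ i)` (`Maynard2016Lemma7MainSum`), the finite set
`badPrimes7 k x m p₀ i` of `Maynard2016Lemma7Assembly` does the job of `badPrimes` in Lemma 6:
* `badPrimes7_spec` — a prime `p ∉ Bad⁷` has `p ∤ m` and an empty coupling set (hypothesis `hBad`
  of `LcmEuler.coupledKernelW_eq_prod`), as soon as `h_j ≤ x < p₀` (`badFactor7_ne_zero`);
* `sum_badPrimes7_log_div_le` — `Σ_{p ∈ Bad⁷} log p / p ≤ (log₂ x + log(5k²+2) + 3)²` for
  `m ≤ x`, `p₀ ≤ x²` (via `badModulus7 = 16 m ∏ |m p₀ (h_l − h_j) + (h_j − h_i)| ≤ 16 x (x⁴+x)^{k²}`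
  and `Maynard2016PrimeDivisorSum`);
* `eventually_epsTotalW7_le` — **`T⁷ = epsTotalW (k−1) (k−1) p₀ τ Bad⁷ → 0`** uniformly in
  `1 ≤ m ≤ x < p₀ ≤ x²`.
All statements PROVED (no named facts).

## References

* J. Maynard, *Large gaps between primes*, Ann. of Math. (2) 183 (2016), 915–933; arXiv:1408.5110,
  §6, proof of Lemma 7 and displays (6.13)–(6.14). [Maynard2016LargeGaps]
-/

noncomputable section

open Filter Finset
open scoped BigOperators Topology

namespace Literature.NumberTheory.Sieve

namespace Maynard2016

open LcmEuler

/-! ### The bad modulus `16 m ∏_{l ≠ j} |m p₀ (h_l − h_j) + (h_j − h_i)|` -/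

/-- The factor `|m p₀ (h_l − h_j) + (h_j − h_i)|` of the pair `(j, l)`. [cite: Maynard2016LargeGaps, Lemma 7 (proof, (Div3))] -/
def badFactor7 (k x m p₀ : ℕ) (i : Fin k) (jl : Fin k × Fin k) : ℕ :=
  ((m : ℤ) * p₀ * ((hTuple k x jl.2 : ℤ) - hTuple k x jl.1) + ((hTuple k x jl.1 : ℤ) - hTuple k x i)).natAbs

/-- `∏_{(j,l), l ≠ j} |m p₀ (h_l − h_j) + (h_j − h_i)|`. [cite: Maynard2016LargeGaps, Lemma 7 (proof, (Div3))] -/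
def badProd7 (k x m p₀ : ℕ) (i : Fin k) : ℕ :=
  ∏ jl ∈ (Finset.univ : Finset (Fin k × Fin k)).filter (fun jl => jl.2 ≠ jl.1), badFactor7 k x m p₀ i jl

/-- `N⁷ := 16 · m · badProd7`. [cite: Maynard2016LargeGaps, Lemma 7 (proof, (Div3))] -/
def badModulus7 (k x m p₀ : ℕ) (i : Fin k) : ℕ := 16 * m * badProd7 k x m p₀ i

/-- `Bad⁷ = primeFactors m ∪ primeFactors badProd7` (definitional). [cite: Maynard2016LargeGaps, Lemma 7 (proof, (Div3))] -/
theorem badPrimes7_eq (k x m p₀ : ℕ) (i : Fin k) :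
    badPrimes7 k x m p₀ i = m.primeFactors ∪ (badProd7 k x m p₀ i).primeFactors := rfl

/-- For `l ≠ j`, `h_ℓ ≤ x < p₀` and `m ≥ 1`: `m p₀ (h_l − h_j) + (h_j − h_i) ≠ 0`
(`|m p₀ (h_l − h_j)| ≥ p₀ > x ≥ |h_j − h_i|`). [cite: Maynard2016LargeGaps, Lemma 7 (proof, (Div3))] -/
theorem badFactor7_ne_zero {k x m p₀ : ℕ} (hm : 1 ≤ m) (hxp : x < p₀) (hH : ∀ i, hTuple k x i ≤ x)
    (i : Fin k) {jl : Fin k × Fin k} (hjl : jl.2 ≠ jl.1) : badFactor7 k x m p₀ i jl ≠ 0 := by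
  unfold badFactor7
  intro h0
  have h0' := Int.natAbs_eq_zero.1 h0
  have hne : (hTuple k x jl.2 : ℤ) ≠ hTuple k x jl.1 := by
    exact_mod_cast fun h => hjl (hTuple_injective k x h)
  have hD : 1 ≤ ((hTuple k x jl.2 : ℤ) - hTuple k x jl.1).natAbs := by
    rw [Nat.one_le_iff_ne_zero]
    exact fun h => hne (by have := Int.natAbs_eq_zero.1 h; linarith)
  have h1 : ((m : ℤ) * p₀ * ((hTuple k x jl.2 : ℤ) - hTuple k x jl.1)).natAbs =
      ((hTuple k x jl.1 : ℤ) - hTuple k x i).natAbs := by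
    have : (m : ℤ) * p₀ * ((hTuple k x jl.2 : ℤ) - hTuple k x jl.1) =
        -(((hTuple k x jl.1 : ℤ) - hTuple k x i)) := by linarith
    rw [this, Int.natAbs_neg]
  have h2 : ((hTuple k x jl.1 : ℤ) - hTuple k x i).natAbs ≤ x :=
    Int.natAbs_coe_sub_coe_le_of_le (hH jl.1) (hH i)
  have h3 : p₀ ≤ ((m : ℤ) * p₀ * ((hTuple k x jl.2 : ℤ) - hTuple k x jl.1)).natAbs := by
    rw [Int.natAbs_mul, Int.natAbs_mul, Int.natAbs_natCast, Int.natAbs_natCast]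
    calc p₀ = 1 * p₀ * 1 := by ring
      _ ≤ m * p₀ * ((hTuple k x jl.2 : ℤ) - hTuple k x jl.1).natAbs :=
          Nat.mul_le_mul (Nat.mul_le_mul_right _ hm) hD
  omega

/-- `badProd7 ≠ 0` under the same hypotheses. [cite: Maynard2016LargeGaps, Lemma 7 (proof, (Div3))] -/
theorem badProd7_ne_zero {k x m p₀ : ℕ} (hm : 1 ≤ m) (hxp : x < p₀) (hH : ∀ i, hTuple k x i ≤ x)
    (i : Fin k) : badProd7 k x m p₀ i ≠ 0 :=
  Finset.prod_ne_zero_iff.2 fun _ hjl => badFactor7_ne_zero hm hxp hH i (Finset.mem_filter.1 hjl).2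

/-- `16 ≤ N⁷`. [cite: Maynard2016LargeGaps, Lemma 7 (proof, (Div3))] -/
theorem sixteen_le_badModulus7 {k x m p₀ : ℕ} (hm : 1 ≤ m) (hxp : x < p₀)
    (hH : ∀ i, hTuple k x i ≤ x) (i : Fin k) : 16 ≤ badModulus7 k x m p₀ i := by
  have h1 : 1 ≤ badProd7 k x m p₀ i := Nat.one_le_iff_ne_zero.2 (badProd7_ne_zero hm hxp hH i)
  unfold badModulus7
  calc 16 = 16 * 1 * 1 := by norm_num
    _ ≤ 16 * m * badProd7 k x m p₀ i := Nat.mul_le_mul (Nat.mul_le_mul_left 16 hm) h1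

/-- `Bad⁷ ⊆ primeFactors N⁷`. [cite: Maynard2016LargeGaps, Lemma 7 (proof, (Div3))] -/
theorem badPrimes7_subset_primeFactors {k x m p₀ : ℕ} (hm : 1 ≤ m) (hxp : x < p₀)
    (hH : ∀ i, hTuple k x i ≤ x) (i : Fin k) :
    badPrimes7 k x m p₀ i ⊆ (badModulus7 k x m p₀ i).primeFactors := by
  have hN : badModulus7 k x m p₀ i ≠ 0 := by
    have := sixteen_le_badModulus7 hm hxp hH i; omega
  rw [badPrimes7_eq]
  refine Finset.union_subset (Nat.primeFactors_mono ?_ hN) (Nat.primeFactors_mono ?_ hN)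
  · exact ⟨16 * badProd7 k x m p₀ i, by unfold badModulus7; ring⟩
  · exact ⟨16 * m, by unfold badModulus7; ring⟩

/-- **`Bad⁷` does its job**: a prime `p ∉ Bad⁷` satisfies `p ∤ m` and
`restrictPairs i i (couplingSet7 p₀ i) p = ∅` (hypothesis `hBad` of `LcmEuler.coupledKernelW_eq_prod`).
[cite: Maynard2016LargeGaps, Lemma 7 (proof, (Div3))] -/
theorem badPrimes7_spec {k x m p₀ : ℕ} (hm : 1 ≤ m) (hxp : x < p₀) (hH : ∀ i, hTuple k x i ≤ x)
    (i : Fin k) (p : ℕ) (hp : p.Prime) (hB : p ∉ badPrimes7 k x m p₀ i) :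
    ¬ p ∣ m ∧ restrictPairs i i (couplingSet7 k x m p₀ i) p = ∅ := by
  rw [badPrimes7_eq, Finset.mem_union, not_or] at hB
  refine ⟨fun h => hB.1 (Nat.mem_primeFactors.2 ⟨hp, h, by omega⟩), ?_⟩
  rw [Finset.eq_empty_iff_forall_notMem]
  intro ab hab
  unfold restrictPairs at hab
  rw [Finset.mem_filter] at hab
  obtain ⟨-, hab⟩ := hab
  obtain ⟨hne, hdvd⟩ := mem_couplingSet7.1 hab
  have h1 : p ∣ badFactor7 k x m p₀ i (ab.1.1, ab.2.1) := by
    unfold badFactor7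
    exact Int.natCast_dvd.1 hdvd
  have h2 : badFactor7 k x m p₀ i (ab.1.1, ab.2.1) ∣ badProd7 k x m p₀ i :=
    Finset.dvd_prod_of_mem _ (Finset.mem_filter.2 ⟨Finset.mem_univ _, hne⟩)
  exact hB.2 (Nat.mem_primeFactors.2 ⟨hp, h1.trans h2, badProd7_ne_zero hm hxp hH i⟩)

/-! ### Size of `N⁷` -/

/-- `|m p₀ (h_l − h_j) + (h_j − h_i)| ≤ x⁴ + x` when `m, h ≤ x`, `p₀ ≤ x²`. [cite: Maynard2016LargeGaps, Lemma 7 (proof, display (6.14))] -/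
theorem badFactor7_le {k x m p₀ : ℕ} (hm : m ≤ x) (hp : p₀ ≤ x ^ 2) (hH : ∀ i, hTuple k x i ≤ x)
    (i : Fin k) (jl : Fin k × Fin k) : badFactor7 k x m p₀ i jl ≤ x ^ 4 + x := by
  unfold badFactor7
  have h1 : ((hTuple k x jl.2 : ℤ) - hTuple k x jl.1).natAbs ≤ x :=
    Int.natAbs_coe_sub_coe_le_of_le (hH jl.2) (hH jl.1)
  have h2 : ((hTuple k x jl.1 : ℤ) - hTuple k x i).natAbs ≤ x :=
    Int.natAbs_coe_sub_coe_le_of_le (hH jl.1) (hH i)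
  have h3 : ((m : ℤ) * p₀ * ((hTuple k x jl.2 : ℤ) - hTuple k x jl.1)).natAbs ≤ x ^ 4 := by
    rw [Int.natAbs_mul, Int.natAbs_mul, Int.natAbs_natCast, Int.natAbs_natCast]
    calc m * p₀ * ((hTuple k x jl.2 : ℤ) - hTuple k x jl.1).natAbs ≤ x * x ^ 2 * x :=
          Nat.mul_le_mul (Nat.mul_le_mul hm hp) h1
      _ = x ^ 4 := by ring
  exact (Int.natAbs_add_le _ _).trans (Nat.add_le_add h3 h2)

/-- `N⁷ ≤ 16 x (x⁴ + x)^{k²}` when `m, h ≤ x`, `p₀ ≤ x²`, `x ≥ 1`. [cite: Maynard2016LargeGaps, Lemma 7 (proof, display (6.14))] -/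
theorem badModulus7_le {k x m p₀ : ℕ} (hx : 1 ≤ x) (hm : m ≤ x) (hp : p₀ ≤ x ^ 2)
    (hH : ∀ i, hTuple k x i ≤ x) (i : Fin k) :
    badModulus7 k x m p₀ i ≤ 16 * x * (x ^ 4 + x) ^ (k * k) := by
  unfold badModulus7 badProd7
  refine Nat.mul_le_mul (Nat.mul_le_mul_left 16 hm) ?_
  refine (Finset.prod_le_pow_card _ _ _ fun jl _ => badFactor7_le hm hp hH i jl).trans ?_
  refine Nat.pow_le_pow_right (by nlinarith) ?_
  refine (Finset.card_filter_le _ _).trans ?_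
  simp [Finset.card_univ]

/-- `log N⁷ ≤ (5k² + 2) log x` for `x ≥ 16`, `m, h ≤ x`, `p₀ ≤ x²`. [cite: Maynard2016LargeGaps, Lemma 7 (proof, display (6.14))] -/
theorem log_badModulus7_le {k x m p₀ : ℕ} (hx : 16 ≤ x) (hm : m ≤ x) (hp : p₀ ≤ x ^ 2)
    (hH : ∀ i, hTuple k x i ≤ x) (i : Fin k) :
    Real.log (badModulus7 k x m p₀ i) ≤ (5 * (k : ℝ) * k + 2) * Real.log x := by
  have hx0 : (0 : ℝ) < x := by exact_mod_cast (show 0 < x by omega)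
  have hx1 : (1 : ℝ) ≤ x := by exact_mod_cast (show 1 ≤ x by omega)
  have hlogx : 0 ≤ Real.log x := Real.log_nonneg hx1
  have hlog2 : Real.log 2 ≤ Real.log x := Real.log_le_log two_pos (by exact_mod_cast (by omega : 2 ≤ x))
  have hlog16 : Real.log 16 ≤ Real.log x := Real.log_le_log (by norm_num) (by exact_mod_cast hx)
  have hN : (badModulus7 k x m p₀ i : ℝ) ≤ 16 * x * ((x : ℝ) ^ 4 + x) ^ (k * k) := by
    exact_mod_cast badModulus7_le (by omega) hm hp hH i
  by_cases hN0 : badModulus7 k x m p₀ i = 0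
  · rw [hN0]; simp; positivity
  have hNpos : (0 : ℝ) < badModulus7 k x m p₀ i := by exact_mod_cast Nat.pos_of_ne_zero hN0
  have h4 : Real.log ((x : ℝ) ^ 4 + x) ≤ 5 * Real.log x := by
    have h41 : (x : ℝ) ^ 4 + x ≤ 2 * (x : ℝ) ^ 4 := by
      have h3 : (1 : ℝ) ≤ (x : ℝ) ^ 3 := one_le_pow₀ hx1
      nlinarith [mul_le_mul_of_nonneg_left h3 hx0.le]
    calc Real.log ((x : ℝ) ^ 4 + x) ≤ Real.log (2 * (x : ℝ) ^ 4) :=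
          Real.log_le_log (by positivity) h41
      _ = Real.log 2 + 4 * Real.log x := by
          rw [Real.log_mul two_ne_zero (by positivity), Real.log_pow]; norm_num
      _ ≤ 5 * Real.log x := by linarith
  calc Real.log (badModulus7 k x m p₀ i) ≤ Real.log (16 * x * ((x : ℝ) ^ 4 + x) ^ (k * k)) :=
        Real.log_le_log hNpos hN
    _ = Real.log 16 + Real.log x + (k * k : ℕ) * Real.log ((x : ℝ) ^ 4 + x) := by
        rw [Real.log_mul (by positivity) (by positivity), Real.log_mul (by norm_num) hx0.ne',
          Real.log_pow]
    _ ≤ Real.log x + Real.log x + (k * k : ℕ) * (5 * Real.log x) := by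
        gcongr
    _ = (5 * (k : ℝ) * k + 2) * Real.log x := by push_cast; ring

/-- **`Σ_{p ∈ Bad⁷} log p / p ≤ (log₂ x + log(5k²+2) + 3)²`** for `x ≥ 16`, `1 ≤ m ≤ x < p₀ ≤ x²`.
[cite: Maynard2016LargeGaps, Lemma 7 (proof, display (6.14))] -/
theorem sum_badPrimes7_log_div_le {k x m p₀ : ℕ} (hx : 16 ≤ x) (hm1 : 1 ≤ m) (hm : m ≤ x)
    (hxp : x < p₀) (hp : p₀ ≤ x ^ 2) (hH : ∀ i, hTuple k x i ≤ x) (i : Fin k) :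
    ∑ p ∈ badPrimes7 k x m p₀ i, Real.log p / p ≤
      (Real.log (Real.log x) + Real.log (5 * (k : ℝ) * k + 2) + 3) ^ 2 := by
  have h16 := sixteen_le_badModulus7 hm1 hxp hH i
  have h0 : ∑ p ∈ badPrimes7 k x m p₀ i, Real.log p / p ≤
      ∑ p ∈ (badModulus7 k x m p₀ i).primeFactors, Real.log p / p :=
    Finset.sum_le_sum_of_subset_of_nonneg (badPrimes7_subset_primeFactors hm1 hxp hH i)
      fun p hp _ => div_nonneg
        (Real.log_nonneg (by exact_mod_cast (Nat.prime_of_mem_primeFactors hp).one_lt.le))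
        (Nat.cast_nonneg _)
  refine h0.trans ((sum_primeFactors_log_div_le h16).trans ?_)
  have hx1 : (1 : ℝ) < x := by exact_mod_cast (show 1 < x by omega)
  have hlogx : 0 < Real.log x := Real.log_pos hx1
  have hNpos : (1 : ℝ) < badModulus7 k x m p₀ i := by
    exact_mod_cast (show 1 < badModulus7 k x m p₀ i by omega)
  have hlogN : 0 < Real.log (badModulus7 k x m p₀ i) := Real.log_pos hNpos
  have h2 : Real.log (Real.log (badModulus7 k x m p₀ i)) ≤
      Real.log (Real.log x) + Real.log (5 * (k : ℝ) * k + 2) := by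
    rw [← Real.log_mul hlogx.ne' (by positivity)]
    refine Real.log_le_log hlogN ?_
    rw [mul_comm]
    exact log_badModulus7_le hx hm hp hH i
  have hlhs : 0 ≤ Real.log (Real.log (badModulus7 k x m p₀ i)) + 3 := by
    have h16' : Real.log 16 ≤ Real.log (badModulus7 k x m p₀ i) :=
      Real.log_le_log (by norm_num) (by exact_mod_cast h16)
    have hl16 : 1 ≤ Real.log 16 := by
      rw [show (16 : ℝ) = 2 ^ 4 by norm_num, Real.log_pow]; norm_num
      linarith [Real.log_two_gt_d9]
    have : 0 ≤ Real.log (Real.log (badModulus7 k x m p₀ i)) := Real.log_nonneg (hl16.trans h16')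
    linarith
  exact pow_le_pow_left₀ hlhs (by linarith) 2

/-! ### `T⁷ → 0` -/

/-- `(log log x)^n / √(log x) → 0` along `x : ℕ`. [folklore] -/
private theorem tendsto_loglog_pow_div_sqrt_log7 (n : ℕ) :
    Tendsto (fun x : ℕ => (Real.log (Real.log x)) ^ n / Real.sqrt (Real.log x)) atTop (𝓝 0) := by
  have h := (isLittleO_log_rpow_rpow_atTop (n : ℝ) (show (0 : ℝ) < 1 / 2 by norm_num)).tendsto_div_nhds_zero
  have h' : Tendsto (fun L : ℝ => (Real.log L) ^ n / Real.sqrt L) atTop (𝓝 0) := by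
    refine h.congr' ?_
    filter_upwards [eventually_ge_atTop (1 : ℝ)] with L hL
    rw [Real.rpow_natCast, Real.sqrt_eq_rpow]
  exact (h'.comp Real.tendsto_log_atTop).comp tendsto_natCast_atTop_atTop

/-- **`T⁷ → 0` uniformly** (the analogue of (6.14) for Lemma 7): for `ε < 1`, `k`, `η > 0`:
eventually in `x`, for all `1 ≤ m ≤ x < p₀ ≤ x²` and every slot `i`,
`epsTotalW (k−1) (k−1) (⌊w⌋+1) (2√(log x)/log y) Bad⁷ ≤ η`.
[cite: Maynard2016LargeGaps, Lemma 7 (proof, display (6.14))] -/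
theorem eventually_epsTotalW7_le {ε : ℝ} (hε : ε < 1) (k : ℕ) {η : ℝ} (hη : 0 < η) :
    ∀ᶠ x : ℕ in atTop, ∀ m p₀ : ℕ, ∀ i : Fin k, 1 ≤ m → m ≤ x → x < p₀ → (p₀ : ℝ) ≤ (x : ℝ) ^ 2 →
      epsTotalW (k - 1) (k - 1) (p0 x) (tauX ε x) (badPrimes7 k x m p₀ i) ≤ η := by
  -- constants
  set A : ℝ := 6 ^ ((k - 1) + (k - 1)) with hA
  set C₂ : ℝ := badConstW (k - 1) (k - 1) with hC₂
  set Ck : ℝ := Real.log (5 * (k : ℝ) * k + 2) + 3 with hCk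
  set B : ℝ := 16 * ((((k - 1 : ℕ)) : ℝ) + ((k - 1 : ℕ) : ℝ) * ((k - 1 : ℕ) : ℝ)) with hB
  have hA0 : 0 < A := by positivity
  have hC₂0 : 0 ≤ C₂ := badConstW_nonneg _ _
  have hCk0 : 0 ≤ Ck := by
    have : 0 ≤ Real.log (5 * (k : ℝ) * k + 2) := Real.log_nonneg (by nlinarith [sq_nonneg (k : ℝ)])
    rw [hCk]; linarith
  have hB0 : 0 ≤ B := by positivity
  -- the two small quantities
  have h1 : Tendsto (fun x : ℕ => (p0 x : ℝ)⁻¹) atTop (𝓝 0) := by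
    refine tendsto_inv_atTop_zero.comp ?_
    refine tendsto_atTop_atTop.2 fun C => ?_
    obtain ⟨N, hN⟩ := (eventually_le_p0 C).exists_forall_of_atTop
    exact ⟨N, hN⟩
  have h2 : Tendsto (fun x : ℕ => (Real.log (Real.log x) + Ck) ^ 3 / Real.sqrt (Real.log x))
      atTop (𝓝 0) := by
    have h8 := (tendsto_loglog_pow_div_sqrt_log7 3).const_mul 8
    rw [mul_zero] at h8
    have hT₂ : Tendsto (fun x : ℕ => Real.log (Real.log (x : ℝ))) atTop atTop :=
      (Real.tendsto_log_atTop.comp Real.tendsto_log_atTop).comp tendsto_natCast_atTop_atTop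
    refine squeeze_zero' ?_ ?_ h8
    · filter_upwards [eventually_iteratedLogs] with x hx
      obtain ⟨hL, hL₂, -⟩ := hx
      exact div_nonneg (pow_nonneg (by linarith) 3) (Real.sqrt_nonneg _)
    · filter_upwards [hT₂.eventually_ge_atTop Ck, eventually_iteratedLogs] with x hx hlogs
      obtain ⟨hL, hL₂, -⟩ := hlogs
      rw [← mul_div_assoc]
      refine div_le_div_of_nonneg_right ?_ (Real.sqrt_nonneg _)
      have : Real.log (Real.log x) + Ck ≤ 2 * Real.log (Real.log x) := by linarith
      calc (Real.log (Real.log x) + Ck) ^ 3 ≤ (2 * Real.log (Real.log x)) ^ 3 :=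
            pow_le_pow_left₀ (by linarith) this 3
        _ = 8 * (Real.log (Real.log x)) ^ 3 := by ring
  have hmaj : Tendsto (fun x : ℕ => A * (2 * C₂ * (p0 x : ℝ)⁻¹ +
      B * (2 / (1 - ε) * ((Real.log (Real.log x) + Ck) ^ 3 / Real.sqrt (Real.log x))))) atTop (𝓝 0) := by
    have := ((h1.const_mul (2 * C₂)).add ((h2.const_mul (2 / (1 - ε))).const_mul B)).const_mul A
    simpa using this
  filter_upwards [hmaj.eventually_le_const hη, eventually_iteratedLogs, eventually_hTuple_le k,
    eventually_ge_atTop 16] with x hx hlogs hH hx16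
  obtain ⟨hL, hL₂, hL₃, hL₃L₂, hL₂L, -, -⟩ := hlogs
  intro m p₀ i hm1 hm hxp hp2
  have hp2' : p₀ ≤ x ^ 2 := by exact_mod_cast hp2
  refine le_trans ?_ hx
  have hL0 : 0 < Real.log x := by linarith
  have hsqrt : 0 < Real.sqrt (Real.log x) := Real.sqrt_pos.2 hL0
  have hsq : Real.sqrt (Real.log x) * Real.sqrt (Real.log x) = Real.log x := Real.mul_self_sqrt hL0.le
  have hε1 : 0 < 1 - ε := by linarith
  have hly : Real.log (y ε x) = (1 - ε) * (Real.log x * Real.log (Real.log (Real.log x)) /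
      Real.log (Real.log x)) := log_y ε x
  have hlypos : 0 < Real.log (y ε x) := by
    rw [hly]; exact mul_pos hε1 (div_pos (mul_pos hL0 (by linarith)) (by linarith))
  have hp0pos : (0 : ℝ) < p0 x := by unfold p0; positivity
  have hτ0 : 0 ≤ tauX ε x := by unfold tauX; positivity
  have hτ : tauX ε x ≤ 2 / (1 - ε) * (Real.log (Real.log x) / Real.sqrt (Real.log x)) := by
    unfold tauX
    rw [div_le_iff₀ hlypos, hly]
    have hL₂0 : 0 < Real.log (Real.log x) := by linarith
    rw [show 2 / (1 - ε) * (Real.log (Real.log x) / Real.sqrt (Real.log x)) *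
        ((1 - ε) * (Real.log x * Real.log (Real.log (Real.log x)) / Real.log (Real.log x))) =
        2 * Real.sqrt (Real.log x) * Real.log (Real.log (Real.log x)) by
      field_simp; nlinarith [hsq]]
    nlinarith
  have hS := sum_badPrimes7_log_div_le hx16 hm1 hm hxp hp2' hH i
  have hS0 : 0 ≤ ∑ p ∈ badPrimes7 k x m p₀ i, Real.log p / p :=
    Finset.sum_nonneg fun p hp => by
      have hp' : p.Prime := by
        rw [badPrimes7_eq, Finset.mem_union] at hp
        rcases hp with hp | hp <;> exact Nat.prime_of_mem_primeFactors hp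
      exact div_nonneg (Real.log_nonneg (by exact_mod_cast hp'.one_lt.le)) (Nat.cast_nonneg _)
  have hL₂Ck : 1 ≤ Real.log (Real.log x) + Ck := by linarith
  have hτS : tauX ε x * ∑ p ∈ badPrimes7 k x m p₀ i, Real.log p / p ≤
      2 / (1 - ε) * ((Real.log (Real.log x) + Ck) ^ 3 / Real.sqrt (Real.log x)) := by
    calc tauX ε x * ∑ p ∈ badPrimes7 k x m p₀ i, Real.log p / p
        ≤ (2 / (1 - ε) * (Real.log (Real.log x) / Real.sqrt (Real.log x))) *
            (Real.log (Real.log x) + Ck) ^ 2 := by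
          rw [hCk, ← add_assoc]
          exact mul_le_mul hτ hS hS0 (by positivity)
      _ ≤ 2 / (1 - ε) * ((Real.log (Real.log x) + Ck) ^ 3 / Real.sqrt (Real.log x)) := by
          rw [mul_assoc]
          refine mul_le_mul_of_nonneg_left ?_ (by positivity)
          rw [div_mul_eq_mul_div]
          refine div_le_div_of_nonneg_right ?_ hsqrt.le
          have hL₂le : Real.log (Real.log x) ≤ Real.log (Real.log x) + Ck := by linarith
          nlinarith [mul_le_mul_of_nonneg_right hL₂le (sq_nonneg (Real.log (Real.log x) + Ck))]
  unfold epsTotalW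
  rw [← hA, ← hC₂]
  refine mul_le_mul_of_nonneg_left ?_ hA0.le
  refine add_le_add ?_ ?_
  · rw [div_eq_mul_inv]
  · exact mul_le_mul_of_nonneg_left hτS hB0

end Maynard2016

end Literature.NumberTheory.Sieve

end
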